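import Summits.BirchSwinnertonDyer.BirchSwinnertonDyer.Theses.QuadraticBranchSignedControl
import Summits.BirchSwinnertonDyer.Rank1Residual.Additive.CyclotomicTowerSignedSelmerDual
import HarnessLib

/-!
# Route `QuadraticBranchSignedControl` (rung K8, cell `bsd-potss`), crux `EtaTransportSigned`
# (item stmt-BirchSwinnertonDyer-19115), stub `stub_etaMC_plus`, brick (B1) of the decomposition
# frame: the `η`-EIGEN-DECOMPOSITION of Kobayashi's tower Selmer group under a quadratic character,
# `Sel^ε(E/K₀K_∞) = Sel^ε(E/K₀K_∞)^{1} ⊕ Sel^ε(E/K₀K_∞)^{η}` (`p` odd)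

WHAT. For a number field `K`, a `ℤ_p`-extension `κ` of `K` (`p` odd), a number field `K₀/K` with
`Gal(K̄/K₀)` normal in `Γ_K`, a model `E` of a completion, a sign `ε`, and a character
`η : Γ_K →* ℤˣ` with `ker κ ∩ ker η ≤ Gal(K̄/K₀)` (so that on
`ker κ = Gal(K̄/K_∞^κ)` the character `η` cuts out `Gal(K̄/K₀K_∞^κ) = towerTopSubgroup κ K₀`;
the intended instance is `K = ℚ`, `K₀ = F = ℚ(√p*)`, `η = ω^{(p−1)/2}`) which is non-trivial on
`ker κ` (`K₀ ⊄ K_∞^κ`): the tree's `Sel^ε(E/K₀K_∞)` (cc-typer-6's `towerSignedSelmerInfty W κ K₀ E ε`,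
Kobayashi 2003 Def. 2.1 inside `Γ_K`) is the INTERNAL DIRECT SUM of its `η = 1` component and its
`η`-component (`towerSignedSelmerInftyEta W κ K₀ E 1 ε`, `… η ε`; Kobayashi §4 p. 8: `M = ⊕_η M^η`,
`M^η = ε_η M`, here for the group `Gal(K₀K_∞/K_∞) ≅ ℤ/2` whose order is prime to `p`):
* `exists_addEquiv_prod_towerSignedSelmerInftyEta` — an additive isomorphism
  `Ψ : Sel^{ε,1} × Sel^{ε,η} ≃ Sel^ε` with `Ψ(a, b) = a + b` (existence form; no definition is
  introduced);
* `addEquiv_prod_towerSignedSelmerInftyEta_symm_conjH1` — any such `Ψ` is `Γ_K`-equivariant: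
  `Ψ⁻¹(conj_g s) = (conj_g (Ψ⁻¹ s).1, conj_g (Ψ⁻¹ s).2)` for EVERY `g ∈ Γ_K`.
PROOF. Every class of `H¹(K₀K_∞, E[p^∞])` is killed by a power `pᵏ` (tree, (P)
`exists_pow_smul_subgroupH1_towerTop_eq_zero`), and `p` is odd, so `u = (pᵏ + 1)/2` inverts `2` on
it; `ker κ` acts on `H¹(Gal(K̄/K₀K_∞), ·)` through `{1, conj_τ}` for any `τ ∈ ker κ` with
`η(τ) = −1` (inner automorphisms act trivially, `conjH1_of_mem_holds`; `conj_{στ⁻¹τ} =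
conj_{στ⁻¹} conj_τ`, `conjH1_mul_holds`); so `s = u(s + τs) + u(s − τs)` with the summands in the
two eigen-parts, and `a + b = 0` with `a` invariant, `b` anti-invariant forces `2a = 0`, `a = 0`.
This is brick (B1) of the DISPLAYED frame `hdec` of
`Theorems/QuadraticBranchSignedControlEtaTransportPlusOfDecomposition.lean` (the Γ-equivariant
decomposition `Sel⁺(V'/F_∞) ≃ Sel⁺(V/ℚ_∞) ⊕ Sel⁺(V/K_∞)^η`); bricks (A) `F`-internal ↔ `ℚ`-internal,
(B2) = ctrl's (i-e) + the model transfer (i-f), (B3) = (D3⁺) at `F` and at `K₀` remain.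

HONEST FRAMING (cell `bsd-potss`, run/shared/lean/pub/bsd-potss/; FULL-BSD rank ≤ 1 programme):
TOOL THEOREMS ONLY — no definition, no named Literature fact, no `sorry`, axioms standard;
UNCONDITIONAL (pure Galois-cohomology bookkeeping on the tree's objects). Nothing about (C1_η),
Kobayashi's theorems or `BSD(W, p)` is claimed; no label or count moves. Seat `bsd-potss-k8q-c3`
(prover), g0.

References: [Kobayashi2003] §4 p. 8 (`M^η = ε_η M`; the `η`-components of `X^±(E/K_∞)`), Def. 2.1
(p. 5), §2 p. 4 (`K_∞ = K₀ℚ_∞`); [GreenbergLNM1716] §1 (p. 60), §3 (descent for groups of order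
prime to `p`); [SerreGaloisCohomology1997] I.§2.5 (inner automorphisms act trivially).
-/

set_option autoImplicit false
set_option linter.dupNamespace false

noncomputable section

open scoped Classical

open Field WeierstrassCurve
open Literature.NumberTheory.EllipticCurves
open Literature.NumberTheory.GaloisRepresentations
open Summit.BirchSwinnertonDyer.Rank1Residual.Additive

universe u

namespace Summit.BirchSwinnertonDyer.BirchSwinnertonDyer.Theorems

variable {K : Type u} [Field K] (W : WeierstrassCurve K) {p : ℕ} [Fact p.Prime]
  (κ : ZpExtension K p) (K₀ : Type u) [Field K₀] [Algebra K K₀]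
  (η : absoluteGaloisGroup K →* ℤˣ)

/-- For `p` odd, a class killed by `pᵏ` and by `2` is zero (`gcd(2, pᵏ) = 1`:
`x = (pᵏ + 1)•x = ((pᵏ + 1)/2)•(2•x)`). [folklore] -/
theorem eq_zero_of_prime_pow_nsmul_eq_zero_of_two_nsmul_eq_zero {A : Type*} [AddCommGroup A]
    (hp2 : p ≠ 2) {x : A} {k : ℕ} (hk : p ^ k • x = 0) (h2 : 2 • x = 0) : x = 0 := by
  have hodd : Odd (p ^ k) := ((Fact.out : p.Prime).odd_of_ne_two hp2).pow
  obtain ⟨m, hm⟩ := hodd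
  calc x = (p ^ k + 1) • x := by rw [add_nsmul, hk, one_nsmul, zero_add]
    _ = (m + 1) • (2 • x) := by rw [hm, ← mul_nsmul']; congr 1; ring
    _ = 0 := by rw [h2, nsmul_zero]

/-- For `p` odd and a class `s` killed by `pᵏ`: `((pᵏ + 1)/2) • (2 • s) = s` — `(pᵏ + 1)/2`
inverts `2` on `s`. [folklore] -/
theorem half_nsmul_two_nsmul_eq {A : Type*} [AddCommGroup A] (hp2 : p ≠ 2) {s : A} {k : ℕ}
    (hk : p ^ k • s = 0) : ((p ^ k + 1) / 2) • (2 • s) = s := by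
  have hodd : Odd (p ^ k) := ((Fact.out : p.Prime).odd_of_ne_two hp2).pow
  have heven : Even (p ^ k + 1) := hodd.add_one
  rw [← mul_nsmul', Nat.div_mul_cancel (even_iff_two_dvd.mp heven), add_nsmul, hk, one_nsmul,
    zero_add]

/-- **On `H¹(Gal(K̄/K₀K_∞^κ), E[p^∞])` an element `σ ∈ ker κ` with `η(σ) = 1` acts trivially** when
`ker κ ∩ ker η ≤ Gal(K̄/K₀)`: then `σ ∈ towerTopSubgroup κ K₀`, an inner automorphism
(`conjH1_of_mem_holds`). [cite: SerreGaloisCohomology1997, I.§2.5] -/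
theorem conjH1_towerTop_eq_id_of_eta_eq_one [(galRange (K := K) K₀).Normal]
    (hη : ∀ σ ∈ κ.kerSubgroup, η σ = 1 → σ ∈ galRange (K := K) K₀)
    {σ : absoluteGaloisGroup K} (hσ : σ ∈ κ.kerSubgroup) (h1 : η σ = 1) :
    W.conjH1 p (towerTopSubgroup κ K₀) σ = AddMonoidHom.id _ :=
  W.conjH1_of_mem_holds p (towerTopSubgroup κ K₀)
    ((mem_towerTopSubgroup_iff κ K₀ σ).mpr ⟨hσ, hη σ hσ h1⟩)

/-- **On `H¹(Gal(K̄/K₀K_∞^κ), E[p^∞])` two elements `σ, τ ∈ ker κ` with `η(σ) = η(τ) = −1` act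
alike**: `στ⁻¹ ∈ ker κ ∩ ker η ≤ towerTopSubgroup κ K₀` acts trivially and
`conj_σ = conj_{στ⁻¹} ∘ conj_τ`. [cite: SerreGaloisCohomology1997, I.§2.5] -/
theorem conjH1_towerTop_eq_of_eta_ne_one [(galRange (K := K) K₀).Normal]
    (hη : ∀ σ ∈ κ.kerSubgroup, η σ = 1 → σ ∈ galRange (K := K) K₀)
    {σ τ : absoluteGaloisGroup K} (hσ : σ ∈ κ.kerSubgroup) (hσ1 : η σ ≠ 1)
    (hτ : τ ∈ κ.kerSubgroup) (hτ1 : η τ ≠ 1) :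
    W.conjH1 p (towerTopSubgroup κ K₀) σ = W.conjH1 p (towerTopSubgroup κ K₀) τ := by
  have hσ' : η σ = -1 := (Int.units_eq_one_or (η σ)).resolve_left hσ1
  have hτ' : η τ = -1 := (Int.units_eq_one_or (η τ)).resolve_left hτ1
  have hmem : σ * τ⁻¹ ∈ towerTopSubgroup κ K₀ := by
    refine (mem_towerTopSubgroup_iff κ K₀ _).mpr ⟨mul_mem hσ (inv_mem hτ), hη _ (mul_mem hσ (inv_mem hτ)) ?_⟩
    rw [map_mul, map_inv, hσ', hτ', inv_neg, inv_one, neg_mul_neg, one_mul]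
  calc W.conjH1 p (towerTopSubgroup κ K₀) σ
      = W.conjH1 p (towerTopSubgroup κ K₀) (σ * τ⁻¹ * τ) := by rw [inv_mul_cancel_right]
    _ = (W.conjH1 p (towerTopSubgroup κ K₀) (σ * τ⁻¹)).comp
          (W.conjH1 p (towerTopSubgroup κ K₀) τ) :=
        W.conjH1_mul_holds p (towerTopSubgroup κ K₀) (σ * τ⁻¹) τ
    _ = W.conjH1 p (towerTopSubgroup κ K₀) τ := by
        rw [W.conjH1_of_mem_holds p (towerTopSubgroup κ K₀) hmem, AddMonoidHom.id_comp]

/-- `conj_τ ∘ conj_τ = id` on `H¹(Gal(K̄/K₀K_∞^κ), E[p^∞])` for `τ ∈ ker κ` (`τ² ∈ ker κ ∩ ker η`,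
`η` being `{±1}`-valued). [cite: SerreGaloisCohomology1997, I.§2.5] -/
theorem conjH1_towerTop_conjH1_self [(galRange (K := K) K₀).Normal]
    (hη : ∀ σ ∈ κ.kerSubgroup, η σ = 1 → σ ∈ galRange (K := K) K₀)
    {τ : absoluteGaloisGroup K} (hτ : τ ∈ κ.kerSubgroup)
    (x : W.subgroupH1 p (towerTopSubgroup κ K₀)) :
    W.conjH1 p (towerTopSubgroup κ K₀) τ (W.conjH1 p (towerTopSubgroup κ K₀) τ x) = x := by
  rw [← AddMonoidHom.comp_apply, ← W.conjH1_mul_holds p (towerTopSubgroup κ K₀) τ τ,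
    conjH1_towerTop_eq_id_of_eta_eq_one W κ K₀ η hη (mul_mem hτ hτ)
      (by rw [map_mul, Int.units_mul_self]), AddMonoidHom.id_apply]

/-- **(B1) The `η`-eigen-decomposition `Sel^ε(E/K₀K_∞) = Sel^{ε}(E/K₀K_∞)^{1} ⊕ Sel^{ε}(E/K₀K_∞)^{η}`
(existence form).** For `p` odd and `η : Γ_K →* ℤˣ` with `ker κ ∩ ker η ≤ Gal(K̄/K₀)` and `η`
non-trivial on `ker κ` (then `η` is automatically trivial on `towerTopSubgroup κ K₀`, whose
elements act trivially): there is an additive isomorphism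
`Ψ : Sel^{ε,1} × Sel^{ε,η} ≃ Sel^ε` (the tree's `towerSignedSelmerInftyEta W κ K₀ E 1 ε`,
`towerSignedSelmerInftyEta W κ K₀ E η ε`, `towerSignedSelmerInfty W κ K₀ E ε`) given by
`(a, b) ↦ a + b`. Injective: apply `conj_τ` (`η τ = −1`) to `a + b = 0` to get `a − b = 0`, so
`2a = 0 = pᵏa`, `a = 0`; surjective: `s = u(s + τs) + u(s − τs)`, `u = (pᵏ + 1)/2`, `pᵏ s = 0`,
the summands lying in the two eigen-parts because `ker κ` acts through `{1, conj_τ}`.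
[cite: Kobayashi2003, §4 p. 8 (M^η = ε_η M), Def. 2.1 (p. 5)] [cite: GreenbergLNM1716, §3] -/
theorem exists_addEquiv_prod_towerSignedSelmerInftyEta [NumberField K] [NumberField K₀]
    (E : Type u) [Field E] [Algebra K E] [(galRange (K := K) K₀).Normal] (ε : ℤˣ) (hp2 : p ≠ 2)
    (hη : ∀ σ ∈ κ.kerSubgroup, η σ = 1 → σ ∈ galRange (K := K) K₀)
    (hτ : ∃ τ ∈ κ.kerSubgroup, η τ ≠ 1) :
    ∃ Ψ : towerSignedSelmerInftyEta W κ K₀ E 1 ε × towerSignedSelmerInftyEta W κ K₀ E η ε ≃+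
        towerSignedSelmerInfty W κ K₀ E ε,
      ∀ x, ((Ψ x : towerSignedSelmerInfty W κ K₀ E ε) :
          W.subgroupH1 p (towerTopSubgroup κ K₀)) =
        (x.1 : W.subgroupH1 p (towerTopSubgroup κ K₀)) + (x.2 : W.subgroupH1 p (towerTopSubgroup κ K₀)) := by
  obtain ⟨τ, hτκ, hτ1⟩ := hτ
  have hτ' : η τ = -1 := (Int.units_eq_one_or (η τ)).resolve_left hτ1
  set H := towerTopSubgroup κ K₀ with hH
  -- the sum map
  let f : towerSignedSelmerInftyEta W κ K₀ E 1 ε × towerSignedSelmerInftyEta W κ K₀ E η ε →+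
      towerSignedSelmerInfty W κ K₀ E ε :=
    { toFun := fun x => ⟨(x.1 : W.subgroupH1 p H) + (x.2 : W.subgroupH1 p H),
        add_mem (towerSignedSelmerInftyEta_le W κ K₀ E 1 ε x.1.2)
          (towerSignedSelmerInftyEta_le W κ K₀ E η ε x.2.2)⟩
      map_zero' := by ext; simp
      map_add' := fun x y => by
        ext
        simp only [Prod.fst_add, Prod.snd_add, AddSubgroup.coe_add, AddMemClass.mk_add_mk]
        abel }
  have hf : ∀ x, ((f x : towerSignedSelmerInfty W κ K₀ E ε) : W.subgroupH1 p H) =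
      (x.1 : W.subgroupH1 p H) + (x.2 : W.subgroupH1 p H) := fun x => rfl
  -- how `conj_τ` acts on the two eigen-parts
  have hτ_one : ∀ a : towerSignedSelmerInftyEta W κ K₀ E 1 ε,
      W.conjH1 p H τ (a : W.subgroupH1 p H) = a := fun a => by
    have h := ((mem_towerSignedSelmerInftyEta_iff W κ K₀ E 1 ε _).mp a.2).2 τ hτκ
    rwa [MonoidHom.one_apply, Units.val_one, one_zsmul] at h
  have hτ_eta : ∀ b : towerSignedSelmerInftyEta W κ K₀ E η ε,
      W.conjH1 p H τ (b : W.subgroupH1 p H) = -b := fun b => by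
    have h := ((mem_towerSignedSelmerInftyEta_iff W κ K₀ E η ε _).mp b.2).2 τ hτκ
    rwa [hτ', Units.val_neg, Units.val_one, neg_one_zsmul] at h
  have hinj : Function.Injective f := by
    intro x y hxy
    have h0 : ((x.1 : W.subgroupH1 p H) - y.1) + ((x.2 : W.subgroupH1 p H) - y.2) = 0 := by
      have := congrArg (fun z : towerSignedSelmerInfty W κ K₀ E ε => (z : W.subgroupH1 p H)) hxy
      simp only [hf] at this
      rw [sub_add_sub_comm, this, sub_self]
    -- apply `conj_τ`
    have h1 : ((x.1 : W.subgroupH1 p H) - y.1) - ((x.2 : W.subgroupH1 p H) - y.2) = 0 := by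
      have := congrArg (W.conjH1 p H τ) h0
      rw [map_add, map_sub, map_sub, map_zero, hτ_one, hτ_one, hτ_eta, hτ_eta] at this
      rw [← this]; abel
    have h2a : 2 • ((x.1 : W.subgroupH1 p H) - y.1) = 0 := by
      have e : 2 • ((x.1 : W.subgroupH1 p H) - y.1) =
          (((x.1 : W.subgroupH1 p H) - y.1) + ((x.2 : W.subgroupH1 p H) - y.2)) +
            (((x.1 : W.subgroupH1 p H) - y.1) - ((x.2 : W.subgroupH1 p H) - y.2)) := by abel
      rw [e, h0, h1, add_zero]
    obtain ⟨k, hk⟩ := exists_pow_smul_subgroupH1_towerTop_eq_zero W κ K₀ ((x.1 : W.subgroupH1 p H) - y.1)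
    have ha : (x.1 : W.subgroupH1 p H) - y.1 = 0 :=
      eq_zero_of_prime_pow_nsmul_eq_zero_of_two_nsmul_eq_zero (p := p) hp2 hk h2a
    have hb : (x.2 : W.subgroupH1 p H) - y.2 = 0 := by rwa [ha, zero_add] at h0
    exact Prod.ext (Subtype.ext (sub_eq_zero.mp ha)) (Subtype.ext (sub_eq_zero.mp hb))
  have hsurj : Function.Surjective f := by
    intro s
    obtain ⟨k, hk⟩ := exists_pow_smul_subgroupH1_towerTop_eq_zero W κ K₀ (s : W.subgroupH1 p H)
    set u : ℕ := (p ^ k + 1) / 2 with hu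
    set cs : W.subgroupH1 p H := W.conjH1 p H τ (s : W.subgroupH1 p H) with hcs
    have hcs_mem : cs ∈ towerSignedSelmerInfty W κ K₀ E ε :=
      conjH1_mem_towerSignedSelmerInfty W κ K₀ E ε τ s.2
    have hτcs : W.conjH1 p H τ cs = s := conjH1_towerTop_conjH1_self W κ K₀ η hη hτκ _
    -- the two halves
    have ha_mem : u • ((s : W.subgroupH1 p H) + cs) ∈ towerSignedSelmerInftyEta W κ K₀ E 1 ε := by
      refine (mem_towerSignedSelmerInftyEta_iff W κ K₀ E 1 ε _).mpr
        ⟨AddSubgroup.nsmul_mem _ (add_mem s.2 hcs_mem) u, fun σ hσ => ?_⟩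
      rw [MonoidHom.one_apply, Units.val_one, one_zsmul]
      by_cases h1 : η σ = 1
      · rw [conjH1_towerTop_eq_id_of_eta_eq_one W κ K₀ η hη hσ h1, AddMonoidHom.id_apply]
      · rw [conjH1_towerTop_eq_of_eta_ne_one W κ K₀ η hη hσ h1 hτκ hτ1, map_nsmul, map_add,
          hτcs, ← hcs, add_comm cs]
    have hb_mem : u • ((s : W.subgroupH1 p H) - cs) ∈ towerSignedSelmerInftyEta W κ K₀ E η ε := by
      refine (mem_towerSignedSelmerInftyEta_iff W κ K₀ E η ε _).mpr
        ⟨AddSubgroup.nsmul_mem _ (sub_mem s.2 hcs_mem) u, fun σ hσ => ?_⟩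
      by_cases h1 : η σ = 1
      · rw [conjH1_towerTop_eq_id_of_eta_eq_one W κ K₀ η hη hσ h1, AddMonoidHom.id_apply, h1,
          Units.val_one, one_zsmul]
      · have hσ' : η σ = -1 := (Int.units_eq_one_or (η σ)).resolve_left h1
        rw [conjH1_towerTop_eq_of_eta_ne_one W κ K₀ η hη hσ h1 hτκ hτ1, map_nsmul, map_sub,
          hτcs, ← hcs, hσ', Units.val_neg, Units.val_one, neg_one_zsmul, ← smul_neg, neg_sub]
    refine ⟨(⟨_, ha_mem⟩, ⟨_, hb_mem⟩), Subtype.ext ?_⟩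
    rw [hf]
    change u • ((s : W.subgroupH1 p H) + cs) + u • ((s : W.subgroupH1 p H) - cs) = s
    rw [← nsmul_add, add_add_sub_cancel, ← two_nsmul, hu, half_nsmul_two_nsmul_eq (p := p) hp2 hk]
  exact ⟨AddEquiv.ofBijective f ⟨hinj, hsurj⟩, fun x => hf x⟩

/-- **Any sum-decomposition `Ψ(a, b) = a + b` of `Sel^ε(E/K₀K_∞)` into its two eigen-parts is
`Γ_K`-equivariant**: `Ψ⁻¹(conj_g s) = (conj_g (Ψ⁻¹ s).1, conj_g (Ψ⁻¹ s).2)` for every `g ∈ Γ_K`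
(both eigen-parts are `conj_g`-stable, `conjH1_mem_towerSignedSelmerInftyEta`, and `conj_g` is
additive). [cite: Kobayashi2003, §4 p. 8 (X^±(E/K_∞)^η as ℤ_p[[Γ]]-modules)] -/
theorem addEquiv_prod_towerSignedSelmerInftyEta_symm_conjH1 [NumberField K] [NumberField K₀]
    (E : Type u) [Field E] [Algebra K E] [(galRange (K := K) K₀).Normal] (ε : ℤˣ)
    (Ψ : towerSignedSelmerInftyEta W κ K₀ E 1 ε × towerSignedSelmerInftyEta W κ K₀ E η ε ≃+
        towerSignedSelmerInfty W κ K₀ E ε)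
    (hΨ : ∀ x, ((Ψ x : towerSignedSelmerInfty W κ K₀ E ε) :
          W.subgroupH1 p (towerTopSubgroup κ K₀)) =
        (x.1 : W.subgroupH1 p (towerTopSubgroup κ K₀)) +
          (x.2 : W.subgroupH1 p (towerTopSubgroup κ K₀)))
    (g : absoluteGaloisGroup K) (s : towerSignedSelmerInfty W κ K₀ E ε) :
    Ψ.symm ⟨W.conjH1 p (towerTopSubgroup κ K₀) g s,
        conjH1_mem_towerSignedSelmerInfty W κ K₀ E ε g s.2⟩ =
      (⟨W.conjH1 p (towerTopSubgroup κ K₀) g ((Ψ.symm s).1 : W.subgroupH1 p (towerTopSubgroup κ K₀)),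
          conjH1_mem_towerSignedSelmerInftyEta W κ K₀ E 1 ε g (Ψ.symm s).1.2⟩,
        ⟨W.conjH1 p (towerTopSubgroup κ K₀) g ((Ψ.symm s).2 : W.subgroupH1 p (towerTopSubgroup κ K₀)),
          conjH1_mem_towerSignedSelmerInftyEta W κ K₀ E η ε g (Ψ.symm s).2.2⟩) := by
  apply Ψ.injective
  rw [AddEquiv.apply_symm_apply]
  apply Subtype.ext
  rw [hΨ]
  change W.conjH1 p (towerTopSubgroup κ K₀) g s =
    W.conjH1 p (towerTopSubgroup κ K₀) g ((Ψ.symm s).1 : W.subgroupH1 p (towerTopSubgroup κ K₀)) +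
      W.conjH1 p (towerTopSubgroup κ K₀) g ((Ψ.symm s).2 : W.subgroupH1 p (towerTopSubgroup κ K₀))
  rw [← map_add, ← hΨ, AddEquiv.apply_symm_apply]

end Summit.BirchSwinnertonDyer.BirchSwinnertonDyer.Theorems

end
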